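import Literature.NumberTheory.EllipticCurves.IwasawaTowerTorsionFiniteProofs
import Literature.NumberTheory.EllipticCurves.IwasawaSelmerControlKernelProofs
import Literature.NumberTheory.EllipticCurves.IwasawaCoinvariantsRankProofs
import Literature.NumberTheory.EllipticCurves.ZpExtensionLayersProofs
import Literature.NumberTheory.EllipticCurves.SelmerCorankAssembly
import Literature.NumberTheory.GaloisRepresentations.AbsGaloisGroupCompact
import HarnessLib

set_option linter.dupNamespace false -- `…BirchSwinnertonDyer.BirchSwinnertonDyer…` is the cell's nested layout (D-0017)
set_option autoImplicit false

/-!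
# Norms of `p`-power torsion points die up a `ℤ_p`-tower of `ℚ`: `N_{ℚ_n/ℚ} (E(ℚ_n)[p^∞]) = 0` for `n ≫ 0`
# (brick (γ)-torsion of the H46 / Lemma 4.6 kernel programme, part 16 of the TorsionEulerChar series)

Cell `bsd-2adic` (run/shared/lean/pub/bsd-2adic/), seat `bsd-2adic-tower-1` GEN 33; `--supports stmt-BirchSwinnertonDyer-19271` (helper).
THEOREMS ONLY (no definition, no named fact, no `sorry`); closes no item; nothing booked; BSD is not proved by any of this.

Context (scope note `HOME/tower/gen33/NOTE-H46-OBSTRUCTION-GEN33.md`): the ONE displayed print input of Greenberg's Thm. 4.1 over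
`ℚ` with rational `p`-torsion — Lemma 4.6 on `Γ`-invariants at an auxiliary place, `Greenberg1999.lemma46_gammaInvariants_auxPlace_rat`
— is equivalent to the vanishing, for `n ≫ 0`, of the corestrictions `cor_{ℚ_n/ℚ} 𝔖(E/ℚ_n) ⊆ 𝔖(E/ℚ) = E(ℚ)(p)` of the compact Selmer
groups down the cyclotomic tower (road B′ of the note). On the TORSION part of `𝔖(E/ℚ_n)` (the Kummer classes of `E(ℚ_n)[p^∞]`)
`cor` is the NORM of points; this file proves that these norms vanish for `n ≫ 0`, for EVERY elliptic `E/ℚ`, every prime `p` and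
every `ℤ_p`-extension of `ℚ` — the torsion half of step (iv) of road B′:

* `sum_range_mul_eq_smul_of_periodic` — bookkeeping: a `T`-periodic sequence sums over `T·t` terms to `t •` its sum over a period;
* **`exists_forall_sum_pow_smul_eq_zero`** — for `W/ℚ` elliptic, `κ` a `ℤ_p`-extension with topological generator `γ`:
  **`∃ m, ∀ n ≥ m, ∀ P ∈ E[p^∞]` fixed by `Gal(ℚ̄/ℚ_n)`, `∑_{i<p^n} γ^i • P = 0`** — i.e. `N_{ℚ_n/ℚ} P = 0`
  (`Gal(ℚ_n/ℚ) = {γ^i}_{i<p^n}`). Proof: `B = E(ℚ_∞)[p^∞]` is finite (tree, Greenberg §1 p. 62 /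
  `finite_fixedPoints_kerSubgroup_geomPrimaryTorsion_rat`), its pointwise stabiliser is open of finite index and contains `ker κ`,
  hence contains `Gal(ℚ̄/ℚ_{n₁})` for some `n₁` (`ZpExtension.exists_layerSubgroup_le`); a uniform `p^e` kills `B`; for `n ≥ n₁ + e`
  the norm is `p^{n−n₁} • ∑_{i<p^{n₁}} γ^i • P = 0` by `p^{n₁}`-periodicity (`γ^{p^{n₁}} ∈ Gal(ℚ̄/ℚ_{n₁})`).

HONEST FRAMING: a brick (the torsion half of one step of one road to H46); nothing about the free part of `𝔖(E/ℚ_n)` (which needs the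
stabilisation of the Selmer coranks and Greenberg's Lemma 3.1), nothing about Poitou–Tate at the layers. Closes no item; no summit
statement is proved; the Birch–Swinnerton-Dyer conjecture is NOT proved by any of this.

References: [GreenbergLNM1716] §1 p. 62 (`E(F_∞)_tors` finite), §3 Lemma 3.1 (p. 86), §4 Lemma 4.6 (p. 105); [Washington1997]
§13.1 (`Gal(K_n/K) = Γ/Γ^{p^n}`); [PerrinRiou1987BSMF] §0 p. 402 (`res ∘ cor = N` on the compact Selmer tower).
-/

noncomputable section

open scoped Classical

open Field

namespace Summit.BirchSwinnertonDyer.BirchSwinnertonDyer.Theorems.TorsionEulerChar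

open Literature.NumberTheory.EllipticCurves Literature.NumberTheory.GaloisRepresentations WeierstrassCurve

/-! ## §1 Periodic sums -/

/-- A `T`-periodic sequence in an additive commutative monoid sums over `T * t` consecutive terms to `t •` its sum over one period.
[folklore] -/
theorem sum_range_mul_eq_smul_of_periodic {A : Type*} [AddCommMonoid A] (f : ℕ → A) (T : ℕ)
    (hf : ∀ i : ℕ, f (T + i) = f i) (t : ℕ) :
    ∑ i ∈ Finset.range (T * t), f i = t • ∑ i ∈ Finset.range T, f i := by
  have hper : ∀ k i : ℕ, f (T * k + i) = f i := by
    intro k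
    induction k with
    | zero => intro i; rw [mul_zero, zero_add]
    | succ k ih => intro i; rw [Nat.mul_succ, add_assoc, ih (T + i), hf i]
  induction t with
  | zero => rw [mul_zero, Finset.sum_range_zero, zero_smul]
  | succ t ih =>
    rw [Nat.mul_succ, Finset.sum_range_add, ih, succ_nsmul]
    congr 1
    exact Finset.sum_congr rfl fun i _ ↦ hper t i

/-! ## §2 Norms of `p`-power torsion points vanish high in the tower -/

/-- **Norms of `p`-power torsion points die up every `ℤ_p`-tower of `ℚ`.** For `W/ℚ` elliptic, `p` prime, `κ : Γ_ℚ ↠ ℤ_p` with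
topological generator `γ`: there is `m` such that for every `n ≥ m` and every `P ∈ E(ℚ̄)[p^∞]` fixed by `Gal(ℚ̄/ℚ_n) = κ⁻¹(p^n ℤ_p)`,
**`∑_{i < p^n} γ^i • P = 0`** (the norm `N_{ℚ_n/ℚ} P`, `Gal(ℚ_n/ℚ) = {γ^i Gal(ℚ̄/ℚ_n)}_{i<p^n}`). Ingredients: `E(ℚ_∞)[p^∞]` finite
(`finite_fixedPoints_kerSubgroup_geomPrimaryTorsion_rat`), open stabilisers (`continuous_smul_geomPrimaryTorsion`), finite-index
subgroups above `ker κ` contain a layer (`ZpExtension.exists_layerSubgroup_le`), `γ^{p^n} ∈ κ⁻¹(p^n ℤ_p)` (`ZpExtension.pow_mem_layerSubgroup`).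
[cite: GreenbergLNM1716, §1 p. 62 and §3 Lemma 3.1 (p. 86)] [cite: Washington1997, §13.1] -/
theorem exists_forall_sum_pow_smul_eq_zero (W : WeierstrassCurve ℚ) [W.IsElliptic] (p : ℕ) [hp : Fact p.Prime]
    (κ : ZpExtension ℚ p) {γ : absoluteGaloisGroup ℚ} (hγ : κ.IsTopGenerator γ) :
    ∃ m : ℕ, ∀ n : ℕ, m ≤ n → ∀ P : geomPrimaryTorsion W p,
      (∀ σ : absoluteGaloisGroup ℚ, σ ∈ κ.layerSubgroup n → σ • P = P) →
      ∑ i ∈ Finset.range (p ^ n), γ ^ i • P = 0 := by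
  have hprime : p.Prime := hp.out
  -- `B = E(ℚ_∞)[p^∞]` is finite
  haveI hB : Finite (FixedPoints.addSubgroup κ.kerSubgroup (geomPrimaryTorsion W p)) :=
    W.finite_fixedPoints_kerSubgroup_geomPrimaryTorsion_rat κ
  set B : AddSubgroup (geomPrimaryTorsion W p) := FixedPoints.addSubgroup κ.kerSubgroup (geomPrimaryTorsion W p) with hBdef
  have hmemB : ∀ P : geomPrimaryTorsion W p, P ∈ B ↔ ∀ τ : absoluteGaloisGroup ℚ, τ ∈ κ.kerSubgroup → τ • P = P := fun P ↦ by
    rw [hBdef, FixedPoints.mem_addSubgroup]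
    constructor
    · intro h τ hτ
      have := h ⟨τ, hτ⟩
      rwa [Subgroup.mk_smul] at this
    · intro h τ
      rw [Subgroup.mk_smul]
      exact h τ τ.2
  -- the pointwise stabiliser of `B`: open, of finite index, above `ker κ`
  let S : Subgroup (absoluteGaloisGroup ℚ) := ⨅ b : B, MulAction.stabilizer (absoluteGaloisGroup ℚ) (b : geomPrimaryTorsion W p)
  have hSmem : ∀ σ : absoluteGaloisGroup ℚ, σ ∈ S ↔ ∀ b : B, σ • (b : geomPrimaryTorsion W p) = b := fun σ ↦ by
    simp only [S, Subgroup.mem_iInf, MulAction.mem_stabilizer_iff]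
  have hSopen : IsOpen (S : Set (absoluteGaloisGroup ℚ)) := by
    have hS : (S : Set (absoluteGaloisGroup ℚ)) =
        ⋂ b : B, (fun σ : absoluteGaloisGroup ℚ ↦ σ • (b : geomPrimaryTorsion W p)) ⁻¹' {(b : geomPrimaryTorsion W p)} := by
      ext σ
      simp only [SetLike.mem_coe, hSmem, Set.mem_iInter, Set.mem_preimage, Set.mem_singleton_iff]
    rw [hS]
    exact isOpen_iInter_of_finite fun b ↦
      (isOpen_discrete _).preimage (continuous_smul_geomPrimaryTorsion W p (b : geomPrimaryTorsion W p))
  haveI : CompactSpace (absoluteGaloisGroup ℚ) := absoluteGaloisGroup_compactSpace ℚ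
  haveI : Finite (absoluteGaloisGroup ℚ ⧸ S) := Subgroup.quotient_finite_of_isOpen _ hSopen
  haveI : S.FiniteIndex := Subgroup.finiteIndex_of_finite_quotient
  have hker : κ.kerSubgroup ≤ S := fun τ hτ ↦ (hSmem τ).mpr fun b ↦ (hmemB b).mp b.2 τ hτ
  obtain ⟨n₁, hn₁⟩ := ZpExtension.exists_layerSubgroup_le (κ := κ) hker Subgroup.FiniteIndex.index_ne_zero
  -- a uniform `p^e` kills `B`
  obtain ⟨e, he⟩ := exists_uniform_pow_smul_eq_zero p ((B : Set (geomPrimaryTorsion W p)))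
    (Set.toFinite _) fun s _ ↦ by
      obtain ⟨k, hk⟩ := (AddCommGroup.mem_primaryComponent).mp s.2
      exact ⟨k, Subtype.ext (by rw [AddSubgroupClass.coe_nsmul, hk, ZeroMemClass.coe_zero])⟩
  refine ⟨n₁ + e, fun n hn P hP ↦ ?_⟩
  -- `P ∈ B`
  have hPB : P ∈ B := (hmemB P).mpr fun τ hτ ↦ hP τ (κ.kerSubgroup_le_layerSubgroup n hτ)
  -- `γ^{p^{n₁}}` fixes `P`, so `i ↦ γ^i • P` is `p^{n₁}`-periodic
  have hfixS : ∀ σ ∈ S, σ • P = P := fun σ hσ ↦ (hSmem σ).mp hσ ⟨P, hPB⟩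
  have hγfix : γ ^ p ^ n₁ • P = P := hfixS _ (hn₁ (ZpExtension.pow_mem_layerSubgroup κ hγ n₁))
  have hperiodic : ∀ i : ℕ, γ ^ (p ^ n₁ + i) • P = γ ^ i • P := fun i ↦ by
    rw [add_comm, pow_add, mul_smul, hγfix]
  -- `∑_{i<p^n} = p^{n-n₁} • ∑_{i<p^{n₁}}`, and `p^{n-n₁} • P = 0`
  obtain ⟨d, hd⟩ := Nat.exists_eq_add_of_le (Nat.le_of_add_right_le hn)
  have hde : e ≤ d := by omega
  have hkill : p ^ d • P = 0 := by
    obtain ⟨d', rfl⟩ := Nat.exists_eq_add_of_le hde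
    rw [pow_add, mul_comm, mul_smul, he P hPB, smul_zero]
  rw [hd, pow_add, sum_range_mul_eq_smul_of_periodic (fun i ↦ γ ^ i • P) (p ^ n₁) hperiodic (p ^ d),
    ← Finset.sum_nsmul]
  refine Finset.sum_eq_zero fun i _ ↦ ?_
  rw [smul_comm, hkill, smul_zero]

end Summit.BirchSwinnertonDyer.BirchSwinnertonDyer.Theorems.TorsionEulerChar

end
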